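import Summits.AtomisticToContinuum.Crystallization.Theorems.FrustratedLawDichotomyAveragingRuleCap

/-!
# FrustratedLawDichotomy · the ball-averaging rule for the ELASTIC currency `E′♭` (credits of both signs): `LAP^{D,E}`, motif-local, literal

`…AveragingRule` / `…AveragingRuleCap` (hand-2 g13, p829595 / p829695) put lens-5's ball-averaged pricing beneath `T′♭` on the motif door as ONE
certified rule (capped flags, under-approximating goodness — safe because every credit of the T-class is nonpositive).  The OTHER finite-range
residual of the Schur split, `E′♭ = SchurElasticPricing η₀ η₁ w ω A eUp κ_E C_E D_E` (level `(eUp − D_E) − (κ_E + C_E)·𝟙[η₀-good] + (κ_E + D_E)·𝟙[η₁-good]`),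
carries a POSITIVE coefficient on `𝟙[η₁-good]`, so the motif must OVER-approximate goodness there: hand-2 g12's `MaybeGoodAt η D`
(`…MotifDoorE`: capped-good OR no other atom within `D`).  This file is the elastic twin of the averaging-rule bridge:

* §1 `maybeGoodFlag η D` is a `ρ₁`-LOCAL feature (`η ≤ 3/10`, `0 ≤ D`, `13/10·D + 1 ≤ ρ₁`; `maybeGoodAt_comp_iff`), and at the cluster level
  `GoodAt η y i → MaybeGoodAt η D y i` (`maybeGoodAt_of_goodAt_self`, injective `y`);
* §2 `surplusCapE η₀ η₁ D W A c₀ cneg cpos` := site term `(Σ_k W(r_jk) − W 0)/2 − A` minus the CAPPED level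
  `c₀ + cneg·goodFlag η₀ D + cpos·maybeGoodFlag η₁ D`; local (`surplusCapE_isLocal`); for `cneg ≤ 0 ≤ cpos` the capped level dominates the true
  level, so ★ `sum_le_of_ballAveragedCapE` : `LAP^{D,E}_ρ := BallAveragedPricingCapE ⟹ c₀·N + cneg·g₀ + cpos·g₁ ≤ U_W − A·N`, hence
  `schurElasticPricing_of_ballAveragedCapE` (`(c₀, cneg, cpos) = (eUp − D_E, −(κ_E + C_E), κ_E + D_E)`);
* §3 ★★ motif-local and literal: `ballAveragedPricingCapE_iff_motif` (`ϱ ≥ ρ + ρ₁`) and `pairRuleMotifCertificateE_avgRule_iff`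
  (`BallAveragedMotifPricingCapE` IS `PairRuleMotifCertificateE … (avgRule ρ surplusCapE)`);
* §4 BY NAME: `schurElasticPricing_fourHalf_of_ballAveragedMotifCapE` and ★★ `aperiodicFrustratedLawGap_fourHalf_of_ballAveragedMotifCaps` —
  `MuEquilibriumDoor ∧ SF₄₅ ∧ UP(−0.7175) ∧ LAP^D on motifs (T-half, W₄₅, e₄₅) ∧ LAP^{D,E} on motifs (E-half) ⟹ AperiodicFrustratedLawGap`:
  BOTH finite-range residuals of column 27623 fed by the ONE parameter-free flat averaging rule on finite motif families (plus the generic form).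

[folklore] bookkeeping; 0 sorry.  Prover hand 2, gen 13 (decomp-a2c), `--supports stmt-AtomisticToContinuum-27623`.
-/

noncomputable section

namespace Summit.AtomisticToContinuum.Crystallization.Theorems.FrustratedLawDichotomyAveragingRuleE

open scoped BigOperators Classical
open Literature.MathematicalPhysics.StatisticalMechanics (interactionEnergy siteEnergy)
open Summit.AtomisticToContinuum.Crystallization.Theorems.ChargedEnergyGapNegative (E3)
open Summit.AtomisticToContinuum.Crystallization.Theorems.FrustratedLawDichotomyRangeCut
open Summit.AtomisticToContinuum.Crystallization.Theorems.FrustratedLawDichotomySchurCut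
open Summit.AtomisticToContinuum.Crystallization.Theorems.FrustratedLawDichotomyLocalPricing (goodCount_eq_sum)
open Summit.AtomisticToContinuum.Crystallization.Theorems.FrustratedLawDichotomyLocalDischargingRule
open Summit.AtomisticToContinuum.Crystallization.Theorems.FrustratedLawDichotomyMotifLemmas
open Summit.AtomisticToContinuum.Crystallization.Theorems.FrustratedLawDichotomyPairPotentialDoor
open Summit.AtomisticToContinuum.Crystallization.Theorems.FrustratedLawDichotomyMotifDoorE
open Summit.AtomisticToContinuum.Crystallization.Theorems.FrustratedLawDichotomyRuleToolkit
open Summit.AtomisticToContinuum.Crystallization.Theorems.FrustratedLawDichotomyRuleToolkitGood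
open Summit.AtomisticToContinuum.Crystallization.Theorems.FrustratedLawDichotomyAveragingCut
  (ball ballAvg mem_ball card_ball_pos sum_ballAvg)
open Summit.AtomisticToContinuum.Crystallization.Theorems.FrustratedLawDichotomyAveragingRule
open Summit.AtomisticToContinuum.Crystallization.Theorems.FrustratedLawDichotomyAveragingRuleCap

/-! ## §1. The over-approximating flag `maybeGoodFlag` is local -/

/-- **`maybeGoodFlag η D`** — the indicator of `MaybeGoodAt η D` (capped-good OR no other atom within `D`) as a site feature. -/
def maybeGoodFlag (η D : ℝ) : SiteFeature := fun _ y i => if MaybeGoodAt η D y i then (1 : ℝ) else 0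

/-- `MaybeGoodAt` agrees between a cluster and any sub-cluster containing every atom within `ρ₁` of the site
(`η ≤ 3/10`, `0 ≤ D`, `13/10·D + 1 ≤ ρ₁`). [folklore] -/
theorem maybeGoodAt_comp_iff {η D ρ₁ : ℝ} (hη : η ≤ 3 / 10) (hD0 : 0 ≤ D) (hD : 13 / 10 * D + 1 ≤ ρ₁) {N M : ℕ} {y : Fin N → E3}
    {φ : Fin M → Fin N} (hφ : Function.Injective φ) {a : Fin M} (hsub : ∀ k : Fin N, dist (y k) (y (φ a)) ≤ ρ₁ → k ∈ Set.range φ) :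
    MaybeGoodAt η D (y ∘ φ) a ↔ MaybeGoodAt η D y (φ a) := by
  constructor
  · rintro (h | h)
    · exact Or.inl (goodAtScale_of_motif hsub hD h)
    · right
      intro k hk
      by_cases hkρ : dist (y k) (y (φ a)) ≤ ρ₁
      · obtain ⟨b, rfl⟩ := hsub k hkρ
        exact h b fun hb => hk (by rw [hb])
      · push Not at hkρ
        linarith
  · rintro (h | h)
    · exact Or.inl (goodAtScale_restrict hsub hD hη h)
    · exact Or.inr fun b hb => h (φ b) fun hh => hb (hφ hh)

/-- ★ `maybeGoodFlag η D` is `ρ₁`-local (`η ≤ 3/10`, `0 ≤ D`, `13/10·D + 1 ≤ ρ₁`). [folklore] -/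
theorem maybeGoodFlag_isLocal {η D ρ₁ : ℝ} (hη : η ≤ 3 / 10) (hD0 : 0 ≤ D) (hD : 13 / 10 * D + 1 ≤ ρ₁) :
    IsLocalFeature ρ₁ (maybeGoodFlag η D) := by
  intro N M y φ hφ a hsub
  unfold maybeGoodFlag
  rw [show (MaybeGoodAt η D (y ∘ φ) a ↔ MaybeGoodAt η D y (φ a)) from maybeGoodAt_comp_iff hη hD0 hD hφ hsub]

/-- ★ **Cluster-good ⟹ maybe-good** at the cluster level (injective `y`, `η ≤ 3/10`): a site good at a scale `> D` has no neighbour within `D`.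
[folklore] -/
theorem maybeGoodAt_of_goodAt_self {η D : ℝ} (hη : η ≤ 3 / 10) {N : ℕ} {y : Fin N → E3} (hy : Function.Injective y) {i : Fin N}
    (h : GoodAt η y i) : MaybeGoodAt η D y i := by
  have key : MaybeGoodAt η D (y ∘ id) i :=
    maybeGood_of_goodAt (ϱ := 13 / 10 * D + 1) hy Function.injective_id (fun k _ => ⟨k, rfl⟩) le_rfl hη h
  exact key

/-! ## §2. The capped elastic surplus, `LAP^{D,E}`, and the kernel towards `E′♭` -/

/-- **`surplusCapE η₀ η₁ D W A c₀ cneg cpos`** — site term minus the CAPPED elastic level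
`c₀ + cneg·𝟙[GoodAtScale η₀ D] + cpos·𝟙[MaybeGoodAt η₁ D]` (use with `cneg ≤ 0 ≤ cpos`). -/
def surplusCapE (η₀ η₁ D : ℝ) (W : ℝ → ℝ) (A c₀ cneg cpos : ℝ) : SiteFeature := fun N y j =>
  ((pairSumFeature W N y j - W 0) / 2 - A) - (c₀ + cneg * goodFlag η₀ D N y j + cpos * maybeGoodFlag η₁ D N y j)

/-- ★ The capped elastic surplus is a `ρ₁`-LOCAL feature (`W` vanishing from `R ≤ ρ₁` on, `η₀, η₁ ≤ 3/10`, `0 ≤ D`, `13/10·D + 1 ≤ ρ₁`). [folklore] -/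
theorem surplusCapE_isLocal {η₀ η₁ D : ℝ} {W : ℝ → ℝ} {A c₀ cneg cpos R ρ₁ : ℝ} (hW : ∀ r, R ≤ r → W r = 0) (hR : R ≤ ρ₁)
    (hη₀ : η₀ ≤ 3 / 10) (hη₁ : η₁ ≤ 3 / 10) (hD0 : 0 ≤ D) (hD : 13 / 10 * D + 1 ≤ ρ₁) :
    IsLocalFeature ρ₁ (surplusCapE η₀ η₁ D W A c₀ cneg cpos) := by
  intro N M y φ hφ a hsub
  unfold surplusCapE
  rw [pairSumFeature_isLocal hW hR N M y φ hφ a hsub, goodFlag_isLocal hη₀ hD N M y φ hφ a hsub,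
    maybeGoodFlag_isLocal hη₁ hD0 hD N M y φ hφ a hsub]

/-- **The capped level dominates the true level** (`cneg ≤ 0 ≤ cpos`, injective `y`, `η₁ ≤ 3/10`): so the capped surplus is BELOW
«site term minus true level». [folklore] -/
theorem surplusCapE_le {η₀ η₁ D : ℝ} {W : ℝ → ℝ} {A c₀ cneg cpos : ℝ} (hneg : cneg ≤ 0) (hpos : 0 ≤ cpos) (hη₁ : η₁ ≤ 3 / 10)
    {N : ℕ} {y : Fin N → E3} (hy : Function.Injective y) (j : Fin N) :
    surplusCapE η₀ η₁ D W A c₀ cneg cpos N y j ≤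
      ((∑ k, W (dist (y j) (y k)) - W 0) / 2 - A) -
        (c₀ + cneg * (if GoodAt η₀ y j then (1 : ℝ) else 0) + cpos * (if GoodAt η₁ y j then (1 : ℝ) else 0)) := by
  unfold surplusCapE goodFlag maybeGoodFlag pairSumFeature
  have h0 := ite_le_ite_of_imp (fun h : GoodAtScale η₀ D y j => h.goodAt)
  have h1 := ite_le_ite_of_imp (fun h : GoodAt η₁ y j => maybeGoodAt_of_goodAt_self (D := D) hη₁ hy h)
  nlinarith [mul_le_mul_of_nonpos_left h0 hneg, mul_le_mul_of_nonneg_left h1 hpos]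

/-- **`LAP^{D,E}_ρ = BallAveragedPricingCapE ρ η₀ η₁ D W A c₀ cneg cpos`** — at every site of every injective `7/10`-separated cluster the ball
average of the capped elastic surpluses is `≥ 0`. -/
def BallAveragedPricingCapE (ρ η₀ η₁ D : ℝ) (W : ℝ → ℝ) (A c₀ cneg cpos : ℝ) : Prop :=
  ∀ (N : ℕ) (y : Fin N → E3), Function.Injective y → Sep y → ∀ i : Fin N,
    0 ≤ ballAvg ρ y (surplusCapE η₀ η₁ D W A c₀ cneg cpos N y) i

/-- ★ **KERNEL**: `LAP^{D,E}_ρ ⟹ c₀·N + cneg·g₀ + cpos·g₁ ≤ U_W − A·N` on every injective Sep cluster (`ρ ≥ 0`, `cneg ≤ 0 ≤ cpos`, `η₁ ≤ 3/10`).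
[folklore] -/
theorem sum_le_of_ballAveragedCapE {ρ η₀ η₁ D : ℝ} {W : ℝ → ℝ} {A c₀ cneg cpos : ℝ} (hρ : 0 ≤ ρ) (hneg : cneg ≤ 0) (hpos : 0 ≤ cpos)
    (hη₁ : η₁ ≤ 3 / 10) (h : BallAveragedPricingCapE ρ η₀ η₁ D W A c₀ cneg cpos)
    (N : ℕ) (y : Fin N → E3) (hy : Function.Injective y) (hsep : Sep y) :
    c₀ * N + cneg * goodCount η₀ y + cpos * goodCount η₁ y ≤ interactionEnergy W y - A * N := by
  have hs := sum_le_interactionEnergy_of_transfers W A y (avgRule ρ (surplusCapE η₀ η₁ D W A c₀ cneg cpos) N y)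
    (ℓ := fun i => c₀ + cneg * (if GoodAt η₀ y i then (1 : ℝ) else 0) + cpos * (if GoodAt η₁ y i then (1 : ℝ) else 0))
    (fun i => by
      have h1 := netInflow_avgRule hρ (surplusCapE η₀ η₁ D W A c₀ cneg cpos) N y i
      have h2 := surplusCapE_le (W := W) (A := A) (c₀ := c₀) (η₀ := η₀) (D := D) hneg hpos hη₁ hy i
      have h3 := h N y hy hsep i
      show c₀ + cneg * (if GoodAt η₀ y i then (1 : ℝ) else 0) + cpos * (if GoodAt η₁ y i then (1 : ℝ) else 0) ≤ _
      unfold netInflow at h1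
      linarith)
  simp only [Finset.sum_add_distrib, Finset.sum_const, Finset.card_univ, Fintype.card_fin, nsmul_eq_mul, ← Finset.mul_sum] at hs
  rw [← goodCount_eq_sum, ← goodCount_eq_sum] at hs
  linarith

/-- ★ **`E′♭ ⟸ LAP^{D,E}_ρ`** with `W = effPot w ω A`, `(c₀, cneg, cpos) = (eUp − D_E, −(κ_E + C_E), κ_E + D_E)` (`κ_E + C_E ≥ 0`, `κ_E + D_E ≥ 0`).
[folklore] -/
theorem schurElasticPricing_of_ballAveragedCapE {ρ η₀ η₁ D A eUp κE CE DE : ℝ} {w ω : ℝ → ℝ} (hρ : 0 ≤ ρ) (hneg : 0 ≤ κE + CE)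
    (hpos : 0 ≤ κE + DE) (hη₁ : η₁ ≤ 3 / 10)
    (h : BallAveragedPricingCapE ρ η₀ η₁ D (effPot w ω A) A (eUp - DE) (-(κE + CE)) (κE + DE)) :
    SchurElasticPricing η₀ η₁ w ω A eUp κE CE DE := by
  intro N y hy hsep
  have := sum_le_of_ballAveragedCapE hρ (by linarith) hpos hη₁ h N y hy hsep
  linarith

/-! ## §3. `LAP^{D,E}` is motif-local; the motif form is literally `PairRuleMotifCertificateE` at the averaging rule -/

/-- **`BallAveragedMotifPricingCapE ρ ϱ …`** — `LAP^{D,E}_ρ` at the CENTRE of injective `7/10`-separated motifs confined to radius `ϱ`. -/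
def BallAveragedMotifPricingCapE (ρ ϱ η₀ η₁ D : ℝ) (W : ℝ → ℝ) (A c₀ cneg cpos : ℝ) : Prop :=
  ∀ (M : ℕ) (z : Fin M → E3), Function.Injective z → Sep z → ∀ c : Fin M, (∀ a : Fin M, dist (z a) (z c) ≤ ϱ) →
    0 ≤ ballAvg ρ z (surplusCapE η₀ η₁ D W A c₀ cneg cpos M z) c

/-- ★ **LITERALLY**: `PairRuleMotifCertificateE … (avgRule ρ surplusCapE) ⟺ LAP^{D,E}` on motifs (`ρ ≥ 0`). [folklore] -/
theorem pairRuleMotifCertificateE_avgRule_iff {ρ ϱ η₀ η₁ D : ℝ} {W : ℝ → ℝ} {A c₀ cneg cpos : ℝ} (hρ : 0 ≤ ρ) :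
    PairRuleMotifCertificateE η₀ η₁ W A c₀ cneg cpos D ϱ (avgRule ρ (surplusCapE η₀ η₁ D W A c₀ cneg cpos)) ↔
      BallAveragedMotifPricingCapE ρ ϱ η₀ η₁ D W A c₀ cneg cpos := by
  refine forall_congr' fun M => forall_congr' fun z => forall_congr' fun _ => forall_congr' fun _ => forall_congr' fun c =>
    forall_congr' fun _ => ?_
  have h := netInflow_avgRule hρ (surplusCapE η₀ η₁ D W A c₀ cneg cpos) M z c
  have e : surplusCapE η₀ η₁ D W A c₀ cneg cpos M z c = ((∑ k, W (dist (z c) (z k)) - W 0) / 2 - A) -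
      (c₀ + cneg * (if GoodAtScale η₀ D z c then (1 : ℝ) else 0) + cpos * (if MaybeGoodAt η₁ D z c then (1 : ℝ) else 0)) := by
    unfold surplusCapE goodFlag maybeGoodFlag pairSumFeature; ring
  constructor
  · intro h1; linarith
  · intro h1; linarith

/-- The motif of a site reproduces its capped elastic ball average (`ϱ ≥ ρ + ρ₁`). [folklore] -/
theorem motif_ballAvgCapE {η₀ η₁ D : ℝ} {W : ℝ → ℝ} {A c₀ cneg cpos R ρ ρ₁ ϱ : ℝ} (hW : ∀ r, R ≤ r → W r = 0)
    (hη₀ : η₀ ≤ 3 / 10) (hη₁ : η₁ ≤ 3 / 10) (hD0 : 0 ≤ D) (h0 : 0 ≤ ρ) (hρ : ρ ≤ ρ₁) (hR : R ≤ ρ₁) (hD : 13 / 10 * D + 1 ≤ ρ₁)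
    (hϱ : ρ + ρ₁ ≤ ϱ) {N : ℕ} {y : Fin N → E3} (hy : Function.Injective y) (hsep : Sep y) (i : Fin N) :
    ∃ (M : ℕ) (z : Fin M → E3) (c : Fin M), Function.Injective z ∧ Sep z ∧ (∀ a : Fin M, dist (z a) (z c) ≤ ϱ) ∧
      ballAvg ρ z (surplusCapE η₀ η₁ D W A c₀ cneg cpos M z) c = ballAvg ρ y (surplusCapE η₀ η₁ D W A c₀ cneg cpos N y) i := by
  set S : Finset (Fin N) := Finset.univ.filter (fun j => dist (y j) (y i) ≤ ϱ) with hS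
  have hSdef0 : ∀ j, j ∈ S ↔ dist (y j) (y i) ≤ ϱ := fun j => by simp [hS]
  have hϱ0 : 0 ≤ ϱ := by linarith
  have hiS : i ∈ S := (hSdef0 i).2 (by rw [dist_self]; exact hϱ0)
  let φ : Fin S.card ↪o Fin N := S.orderEmbOfFin rfl
  have hφ : Set.range φ = ↑S := Finset.range_orderEmbOfFin S rfl
  have hiφ : i ∈ Set.range φ := by rw [hφ]; exact hiS
  obtain ⟨c, hc⟩ := hiφ
  have hSdef : ∀ j, j ∈ S ↔ dist (y j) (y (φ c)) ≤ ϱ := by rw [hc]; exact hSdef0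
  have hSr : ∀ k : Fin N, dist (y k) (y (φ c)) ≤ ϱ → k ∈ Set.range φ := fun k hk => by
    rw [hφ]; exact (hSdef k).2 hk
  have hφinj : Function.Injective φ := φ.injective
  set F : TransferRule := avgRule ρ (surplusCapE η₀ η₁ D W A c₀ cneg cpos) with hF
  have hxloc : IsLocalFeature ρ₁ (surplusCapE η₀ η₁ D W A c₀ cneg cpos) := surplusCapE_isLocal hW hR hη₀ hη₁ hD0 hD
  have hF₁ : HasRange ρ F := avgRule_hasRange _ _
  have hF₂ : IsLocal ρ₁ F := avgRule_isLocal hxloc hρ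
  refine ⟨S.card, y ∘ φ, c, hy.comp hφinj, fun a b hab => hsep (φ a) (φ b) (hφinj.ne hab), fun a => ?_, ?_⟩
  · have ha : φ a ∈ S := by
      have h : φ a ∈ Set.range φ := ⟨a, rfl⟩
      rw [hφ] at h
      exact h
    exact (hSdef (φ a)).1 ha
  · have e1 : surplusCapE η₀ η₁ D W A c₀ cneg cpos S.card (y ∘ φ) c = surplusCapE η₀ η₁ D W A c₀ cneg cpos N y (φ c) :=
      hxloc N S.card y φ hφinj c fun k hk => hSr k (hk.trans (by linarith))
    have e2 : netInflow F S.card (y ∘ φ) c = netInflow F N y (φ c) :=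
      netInflow_motif hF₁ hF₂ hϱ (by linarith) (by linarith) φ hφ hSdef
    have h1 := netInflow_avgRule h0 (surplusCapE η₀ η₁ D W A c₀ cneg cpos) S.card (y ∘ φ) c
    have h2 := netInflow_avgRule h0 (surplusCapE η₀ η₁ D W A c₀ cneg cpos) N y (φ c)
    rw [← hc]
    rw [← hF] at h1 h2
    linarith

/-- ★★ **`LAP^{D,E}` IS MOTIF-LOCAL** (`ϱ ≥ ρ + ρ₁`; `0 ≤ ρ ≤ ρ₁`, `R ≤ ρ₁`, `0 ≤ D`, `13/10·D + 1 ≤ ρ₁`, `η₀, η₁ ≤ 3/10`). [folklore] -/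
theorem ballAveragedPricingCapE_iff_motif {η₀ η₁ D : ℝ} {W : ℝ → ℝ} {A c₀ cneg cpos R ρ ρ₁ ϱ : ℝ} (hW : ∀ r, R ≤ r → W r = 0)
    (hη₀ : η₀ ≤ 3 / 10) (hη₁ : η₁ ≤ 3 / 10) (hD0 : 0 ≤ D) (h0 : 0 ≤ ρ) (hρ : ρ ≤ ρ₁) (hR : R ≤ ρ₁) (hD : 13 / 10 * D + 1 ≤ ρ₁)
    (hϱ : ρ + ρ₁ ≤ ϱ) :
    BallAveragedPricingCapE ρ η₀ η₁ D W A c₀ cneg cpos ↔ BallAveragedMotifPricingCapE ρ ϱ η₀ η₁ D W A c₀ cneg cpos := by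
  constructor
  · exact fun h M z hz hs c _ => h M z hz hs c
  · intro h N y hy hsep i
    obtain ⟨M, z, c, hz, hzs, hconf, heq⟩ :=
      motif_ballAvgCapE (A := A) (c₀ := c₀) (cneg := cneg) (cpos := cpos) hW hη₀ hη₁ hD0 h0 hρ hR hD hϱ hy hsep i
    rw [← heq]
    exact h M z hz hzs c hconf

/-- ★ **`E′♭ ⟸ LAP^{D,E} on motifs`** for any Schur cut whose `effPot` vanishes from `R` on. [folklore chaining] -/
theorem schurElasticPricing_of_ballAveragedMotifCapE {η₀ η₁ D A eUp κE CE DE R ρ ρ₁ ϱ : ℝ} {w ω : ℝ → ℝ}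
    (hW : ∀ r, R ≤ r → effPot w ω A r = 0) (hη₀ : η₀ ≤ 3 / 10) (hη₁ : η₁ ≤ 3 / 10) (hD0 : 0 ≤ D) (h0 : 0 ≤ ρ) (hρ : ρ ≤ ρ₁)
    (hR : R ≤ ρ₁) (hD : 13 / 10 * D + 1 ≤ ρ₁) (hϱ : ρ + ρ₁ ≤ ϱ) (hneg : 0 ≤ κE + CE) (hpos : 0 ≤ κE + DE)
    (h : BallAveragedMotifPricingCapE ρ ϱ η₀ η₁ D (effPot w ω A) A (eUp - DE) (-(κE + CE)) (κE + DE)) :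
    SchurElasticPricing η₀ η₁ w ω A eUp κE CE DE :=
  schurElasticPricing_of_ballAveragedCapE h0 hneg hpos hη₁
    ((ballAveragedPricingCapE_iff_motif hW hη₀ hη₁ hD0 h0 hρ hR hD hϱ).2 h)

/-! ## §4. The record node BY NAME: both halves on the flat averaging rule -/

/-- ★ **`E′♭₄₅(κ_E, C_E, D_E) ⟸ LAP^{D,E}_ρ on radius-ϱ motifs`** for `W₄₅ = effPot w₄₅ ω₄ (3/400)` (`0 ≤ ρ ≤ ρ₁`, `9/2 ≤ ρ₁`, `0 ≤ D`,
`13/10·D + 1 ≤ ρ₁`, `ρ + ρ₁ ≤ ϱ`, `κ_E + C_E, κ_E + D_E ≥ 0`). [folklore chaining] -/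
theorem schurElasticPricing_fourHalf_of_ballAveragedMotifCapE {κE CE DE D ρ ρ₁ ϱ : ℝ} (hD0 : 0 ≤ D) (h0 : 0 ≤ ρ) (hρ : ρ ≤ ρ₁)
    (hR : 9 / 2 ≤ ρ₁) (hD : 13 / 10 * D + 1 ≤ ρ₁) (hϱ : ρ + ρ₁ ≤ ϱ) (hneg : 0 ≤ κE + CE) (hpos : 0 ≤ κE + DE)
    (h : BallAveragedMotifPricingCapE ρ ϱ (1 / 20) (1 / 8) D (effPot w₄₅ ω₄ (3 / 400)) (3 / 400) (-(7175 / 10000) - DE) (-(κE + CE))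
      (κE + DE)) :
    SchurElasticPricing (1 / 20) (1 / 8) w₄₅ ω₄ (3 / 400) (-(7175 / 10000)) κE CE DE :=
  schurElasticPricing_of_ballAveragedMotifCapE (fun _ hr => effPot_fourHalf_eq_zero _ hr) (by norm_num) (by norm_num) hD0 h0 hρ hR hD hϱ
    hneg hpos h

/-- ★★ **The crux `AperiodicFrustratedLawGap` (stmt-27623) BY NAME with BOTH finite-range residuals on the flat averaging rule**:
`MuEquilibriumDoor ∧ SF₄₅ ∧ UP(−0.7175) ∧ LAP^D on motifs (T-half: level (−0.7175 + 1/100, −C_T, −1/100), capped flags)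
∧ LAP^{D,E} on motifs (E-half: level (−0.7175 − D_E, −(1/1000 + C_E), 1/1000 + D_E), maybe-good flag) ⟹ AperiodicFrustratedLawGap`
(`C_T, C_E, D_E ≥ 0`; one geometry `0 ≤ ρ ≤ ρ₁`, `9/2 ≤ ρ₁`, `0 ≤ D`, `13/10·D + 1 ≤ ρ₁`, `ρ + ρ₁ ≤ ϱ`). [folklore chaining] -/
theorem aperiodicFrustratedLawGap_fourHalf_of_ballAveragedMotifCaps {CT CE DE D ρ ρ₁ ϱ : ℝ}
    (hDoor : Summit.AtomisticToContinuum.Crystallization.Theses.GrainCoreNetworkSplit.MuEquilibriumDoor)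
    (hSF : SF₄₅) (hU : PeriodicEnergyCeiling (-(7175 / 10000))) (hCT : 0 ≤ CT) (hCE : 0 ≤ CE) (hDE : 0 ≤ DE)
    (hD0 : 0 ≤ D) (h0 : 0 ≤ ρ) (hρ : ρ ≤ ρ₁) (hR : 9 / 2 ≤ ρ₁) (hD : 13 / 10 * D + 1 ≤ ρ₁) (hϱ : ρ + ρ₁ ≤ ϱ)
    (hT : BallAveragedMotifPricingCap ρ ϱ (1 / 20) (1 / 8) D (effPot w₄₅ ω₄ (3 / 400)) (-(7175 / 10000) + 3 / 400) (1 / 100) CT)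
    (hE : BallAveragedMotifPricingCapE ρ ϱ (1 / 20) (1 / 8) D (effPot w₄₅ ω₄ (3 / 400)) (3 / 400) (-(7175 / 10000) - DE)
      (-(1 / 1000 + CE)) (1 / 1000 + DE)) :
    Summit.AtomisticToContinuum.Crystallization.Theses.FrustratedLawDichotomy.AperiodicFrustratedLawGap :=
  aperiodicFrustratedLawGap_of_split_schurCut (by norm_num) hDoor hSF hU (by norm_num)
    (schurTopologicalPricing_fourHalf_of_ballAveragedMotifCap h0 hρ hR hD hϱ hCT hT) (by norm_num)
    (schurElasticPricing_fourHalf_of_ballAveragedMotifCapE hD0 h0 hρ hR hD hϱ (by linarith) (by linarith) hE)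

/-- **Generic form** (any Schur cut `w ω A` with `effPot` vanishing from `R` on, `1/20 ≤ η₁ ≤ 3/10`). [folklore chaining] -/
theorem aperiodicFrustratedLawGap_of_ballAveragedMotifCaps {η₁ D A eUp κT CT κE CE DE R ρ ρ₁ ϱ : ℝ} {w ω : ℝ → ℝ}
    (h01 : (1 : ℝ) / 20 ≤ η₁) (hη₁ : η₁ ≤ 3 / 10)
    (hDoor : Summit.AtomisticToContinuum.Crystallization.Theses.GrainCoreNetworkSplit.MuEquilibriumDoor)
    (hSF : SchurFloor w ω A) (hU : PeriodicEnergyCeiling eUp) (hκT : 0 < κT) (hκE : 0 < κE) (hCT : 0 ≤ CT) (hCE : 0 ≤ CE) (hDE : 0 ≤ DE)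
    (hW : ∀ r, R ≤ r → effPot w ω A r = 0) (hD0 : 0 ≤ D) (h0 : 0 ≤ ρ) (hρ : ρ ≤ ρ₁) (hR : R ≤ ρ₁) (hD : 13 / 10 * D + 1 ≤ ρ₁)
    (hϱ : ρ + ρ₁ ≤ ϱ)
    (hT : BallAveragedMotifPricingCap ρ ϱ (1 / 20) η₁ D (effPot w ω A) (eUp + A) κT CT)
    (hE : BallAveragedMotifPricingCapE ρ ϱ (1 / 20) η₁ D (effPot w ω A) A (eUp - DE) (-(κE + CE)) (κE + DE)) :
    Summit.AtomisticToContinuum.Crystallization.Theses.FrustratedLawDichotomy.AperiodicFrustratedLawGap :=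
  aperiodicFrustratedLawGap_of_split_schurCut h01 hDoor hSF hU hκT
    (schurTopologicalPricing_of_ballAveragedMotifCap hW (by norm_num) hη₁ h0 hρ hR hD hϱ hκT.le hCT hT) hκE
    (schurElasticPricing_of_ballAveragedMotifCapE hW (by norm_num) hη₁ hD0 h0 hρ hR hD hϱ (by linarith) (by linarith) hE)

end Summit.AtomisticToContinuum.Crystallization.Theorems.FrustratedLawDichotomyAveragingRuleE

end
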